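import Literature.Analysis.FluidPDE.PassiveVectorTensorPropagatorLossMonotone
import Literature.Analysis.FunctionSpaces.TorusTimeAverage
import HarnessLib

/-!
# The loss of the passive-vector propagator with a smooth carrier is controlled by the enstrophy of the datum

Analysis/FluidPDE proof-support file (theorems only; no named facts), sequel of `PassiveVectorTensorPropagatorLossMonotone`.
For the solution propagator `Torus.IsPropagator T b 𝔹 U` of Frisch's tensor passive-vector equation (constant tensor,
`NearIso 𝔹 lo hi`, `0 < lo`) along a smooth carrier `Torus.SmoothCarrier b M G`, and a weakly divergence-free datum
`f ∈ L²` of finite spectral enstrophy `Z(f) = 4π² Σ_k |k|² ‖f̂(k)‖² = eGradNormSq f < ∞`: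

  `‖f‖² − ‖U s t f‖² ≤ 2·|hi|·(t − s)·e^{2·#d·G·(t−s)}·Z(f)`     (`IsPropagator.loss_le_enstrophy`, all `0 ≤ s ≤ t ≤ T`)

— the energy lost on `[s, t]` is at most the time-integrated dissipation of a field whose enstrophy grows at most like
`e^{2#dGτ}` (Temam 1984, Ch. III §2: enstrophy Gronwall for the linear problem; the upper Legendre–Hadamard window `D ≤ |hi|·Z`).
Proved on the Fourier–Galerkin approximants of `PassiveVectorTensorGalerkinSmooth*` (`pvsEnstrophy_le_exp_mul`,
`pvsDiss_le_abs_hi_mul_pvsEnstrophy`, every truncated symbol form below the dissipation rate), passed to the limit pointwise in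
time for each truncated symbol form (finitely many modes), and through the energy identity of the limit
(`IsWeakTensorPassiveVectorOn.ae_tendsto_setIntegral_symbForm`; the limit is the weak solution,
`IsGalerkinLimit.isWeakTensorPassiveVectorOn`), the representation `repr`, continuity of `t ↦ ‖U s t y‖²` and the longer-horizon
propagator for the endpoint (`IsPropagator.of_horizon_le`), exactly as in `PassiveVectorTensorPropagatorLossMonotone`.

Consumer: input (P) of the (N1′) conjunct of `cellInputs_alphaBeta_textR` (K1L_D `stmt-AnomalousDissipation-27980`,
`stub_Z7_alphaBetaR`, cell `ad-ideate`; for a solenoidal real trigonometric polynomial `Z = 4π²Σ_{k∈S}|k|²‖c k‖²`,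
`eGradNormSq_realTrigPoly`).

## References

* R. Temam, *Navier–Stokes Equations*, 3rd ed. (North-Holland 1984), Ch. III §1 Lemma 1.2, §2 (3.41)–(3.47). [`Temam1984`]
* P. Constantin, C. Foias, *Navier–Stokes Equations* (Chicago UP 1988), Ch. 10. [`ConstantinFoias1988`]
* J. C. Robinson, J. L. Rodrigo, W. Sadowski, *The three-dimensional Navier–Stokes equations* (CUP 2016), Thm. 4.4, Thm. 4.6. [`RobinsonRodrigoSadowski2016`]
* U. Frisch, *Turbulence* (CUP 1995), §9.6.3 eq. (9.57). [`Frisch1995Turbulence`]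
-/

open MeasureTheory Set Filter Topology UnitAddTorus Metric Function
open scoped ENNReal NNReal InnerProductSpace

noncomputable section

namespace Literature.Analysis.FluidPDE

namespace Torus

open FunctionSpaces.Torus FunctionSpaces

variable {d : Type*} [Fintype d] [DecidableEq d]

/-! ## §0 Truncated symbol forms (local copies of the private helpers of `PassiveVectorTensorPropagatorLossMonotone`) -/

section SymbForm

/-- Continuity in time of a truncated symbol form along continuous modes. [cite: Frisch1995Turbulence, §9.6.3 eq. (9.57) p. 233] -/
private theorem continuousOn_symbForm₁ (𝔸 : Visc4 d) (K : ℕ) {γ : ℝ → (d → ℤ) → EuclideanSpace ℂ d} {s : Set ℝ}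
    (hγ : ∀ k, ContinuousOn (fun τ => γ τ k) s) :
    ContinuousOn (fun τ => 4 * Real.pi ^ 2 * ∑ k ∈ freqBall K, (⟪γ τ k, symbT 𝔸 k (γ τ k)⟫_ℂ).re) s := by
  refine continuousOn_const.mul (continuousOn_finsetSum _ fun k _ => ?_)
  have hT : ContinuousOn (fun τ => symbT 𝔸 k (γ τ k)) s :=
    ((symbTL 𝔸 (k : d → ℤ)).continuous.comp_continuousOn (hγ k)).congr fun _ _ => rfl
  exact Complex.continuous_re.comp_continuousOn ((hγ k).inner hT)

/-- Modewise convergence passes to a truncated symbol form. [cite: Frisch1995Turbulence, §9.6.3 eq. (9.57) p. 233] -/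
private theorem tendsto_symbForm₁ (𝔸 : Visc4 d) (K : ℕ) {γ : ℕ → (d → ℤ) → EuclideanSpace ℂ d}
    {γ' : (d → ℤ) → EuclideanSpace ℂ d} (hγ : ∀ k, Tendsto (fun n => γ n k) atTop (𝓝 (γ' k))) :
    Tendsto (fun n => 4 * Real.pi ^ 2 * ∑ k ∈ freqBall K, (⟪γ n k, symbT 𝔸 k (γ n k)⟫_ℂ).re) atTop
      (𝓝 (4 * Real.pi ^ 2 * ∑ k ∈ freqBall K, (⟪γ' k, symbT 𝔸 k (γ' k)⟫_ℂ).re)) := by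
  refine tendsto_const_nhds.mul (tendsto_finsetSum _ fun k _ => ?_)
  have hT : Tendsto (fun n => symbT 𝔸 k (γ n k)) atTop (𝓝 (symbT 𝔸 k (γ' k))) := by
    have := ((symbTL 𝔸 (k : d → ℤ)).continuous.tendsto _).comp (hγ k)
    simpa only [Function.comp_def, symbTL_apply] using this
  exact (Complex.continuous_re.tendsto _).comp ((hγ k).inner hT)

end SymbForm

/-! ## §1 The Galerkin side: truncated symbol forms of the limit are below `|hi|·e^{2#dGτ}·Z(w₀)` -/

section Galerkin

variable {𝔸 : Visc4 d} {lo hi : ℝ} {b : ℝ → UnitAddTorus d → EuclideanSpace ℝ d} {M G : ℝ}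
  {w₀ : UnitAddTorus d → EuclideanSpace ℝ d}
  {h : PVSSetup 𝔸 lo hi b M G w₀} {φ : ℕ → ℕ} {c : ℝ → (d → ℤ) → EuclideanSpace ℂ d}
  {w : ℝ → UnitAddTorus d → EuclideanSpace ℝ d}

/-- **The initial Galerkin enstrophy is below the spectral enstrophy of the datum**:
`Z(P_N w₀) = 4π² Σ_{|k|≤N} |k|²‖ŵ₀(k)‖² ≤ eGradNormSq w₀` (finite). [cite: RobinsonRodrigoSadowski2016, Thm. 4.4 Step 2 (4.8)] -/
theorem PVSSetup.pvsEnstrophy_datum_le (h : PVSSetup 𝔸 lo hi b M G w₀) (N : ℕ) (hZ : eGradNormSq w₀ ≠ ⊤) :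
    pvsEnstrophy (freqBall N) (h.galerkinCoeff N 0) ≤ (eGradNormSq w₀).toReal := by
  set X : (d → ℤ) → EuclideanSpace ℂ d := fun k => mFourierCoeff (EuclideanSpace.complexify ∘ w₀) k with hX
  have e : pvsEnstrophy (freqBall N) (h.galerkinCoeff N 0) =
      4 * Real.pi ^ 2 * ∑ k ∈ freqBall N, freqNormSq k * ‖X k‖ ^ 2 := by
    rw [(h.galerkinCoeff_spec N).1, pvsEnstrophy_eq_sum_coeffExt]
    congr 1
    refine Finset.sum_congr rfl fun k hk => ?_
    rw [coeffExt_of_mem _ hk]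
    rfl
  have h2 : ENNReal.ofReal (4 * Real.pi ^ 2 * ∑ k ∈ freqBall N, freqNormSq k * ‖X k‖ ^ 2) ≤ eGradNormSq w₀ := by
    rw [eGradNormSq_eq_tsum, ENNReal.ofReal_mul (by positivity),
      ENNReal.ofReal_sum_of_nonneg (fun k _ => mul_nonneg (freqNormSq_nonneg k) (sq_nonneg _))]
    gcongr
    refine (Finset.sum_le_sum fun k _ => le_of_eq ?_).trans (ENNReal.sum_le_tsum _)
    rw [ENNReal.ofReal_mul (freqNormSq_nonneg k), ← ofReal_norm, ← ENNReal.ofReal_pow (norm_nonneg _)]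
  rw [e]
  exact (ENNReal.ofReal_le_iff_le_toReal hZ).1 h2

/-- **Every truncated symbol form of a Galerkin approximant is below `|hi|·e^{2#dGτ}·Z_N(0)`**: `Q_K ≤ D_N ≤ |hi|·Z_N(τ)`
(upper Legendre–Hadamard window) and `Z_N(τ) ≤ e^{2#dGτ} Z_N(0)` (enstrophy Gronwall). [cite: Temam1984, Ch. III §2 (3.41)–(3.47)] -/
theorem PVSSetup.symbForm_approx_le (h : PVSSetup 𝔸 lo hi b M G w₀) (N K : ℕ) {τ : ℝ} (hτ : 0 ≤ τ) :
    4 * Real.pi ^ 2 * ∑ k ∈ freqBall K,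
        (⟪h.galerkinCoeffAt N τ k, symbT 𝔸 k (h.galerkinCoeffAt N τ k)⟫_ℂ).re ≤
      |hi| * Real.exp (2 * ((Fintype.card d : ℝ) * G) * τ) * pvsEnstrophy (freqBall N) (h.galerkinCoeff N 0) := by
  obtain ⟨-, hmem, -, hsol, -⟩ := h.galerkinCoeff_spec N
  have h1 := sum_re_inner_symbT_le_pvsDiss h.nearIso h.lo_nonneg (hmem τ).2 (freqBall K)
  have h2 := pvsDiss_le_abs_hi_mul_pvsEnstrophy (S := freqBall N) h.nearIso (hmem τ).2 (𝔸 := 𝔸)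
  have h3 := pvsEnstrophy_le_exp_mul h.nearIso h.lo_nonneg (neg_mem_freqBall_of_mem (N := N)) h.carrier (hsol τ)
    (fun t _ => hmem t) le_rfl hτ le_rfl
  rw [sub_zero] at h3
  have h4 := mul_le_mul_of_nonneg_left h3 (abs_nonneg hi)
  calc 4 * Real.pi ^ 2 * ∑ k ∈ freqBall K, (⟪h.galerkinCoeffAt N τ k, symbT 𝔸 k (h.galerkinCoeffAt N τ k)⟫_ℂ).re
      ≤ pvsDiss (freqBall N) 𝔸 (h.galerkinCoeff N τ) := h1
    _ ≤ |hi| * pvsEnstrophy (freqBall N) (h.galerkinCoeff N τ) := h2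
    _ ≤ |hi| * (Real.exp (2 * ((Fintype.card d : ℝ) * G) * τ) * pvsEnstrophy (freqBall N) (h.galerkinCoeff N 0)) := h4
    _ = _ := by ring

/-- **The truncated symbol forms of a Galerkin limit are below `|hi|·e^{2#dGτ}·Z(w₀)`** for every `τ ≥ 0` and every `K`
(modewise limit of `symbForm_approx_le`, `pvsEnstrophy_datum_le`). [cite: Temam1984, Ch. III §2 (3.41)–(3.47)] -/
theorem PVSSetup.IsGalerkinLimit.symbForm_le_enstrophy (hl : h.IsGalerkinLimit φ c w) (K : ℕ) {τ : ℝ} (hτ : 0 ≤ τ)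
    (hZ : eGradNormSq w₀ ≠ ⊤) :
    4 * Real.pi ^ 2 * ∑ k ∈ freqBall K, (⟪c τ k, symbT 𝔸 k (c τ k)⟫_ℂ).re ≤
      |hi| * Real.exp (2 * ((Fintype.card d : ℝ) * G) * τ) * (eGradNormSq w₀).toReal := by
  refine le_of_tendsto' (tendsto_symbForm₁ 𝔸 K fun k => hl.tendsto_coeff τ hτ k) fun n => ?_
  refine (h.symbForm_approx_le (φ n) K hτ).trans ?_
  exact mul_le_mul_of_nonneg_left (h.pvsEnstrophy_datum_le (φ n) hZ) (by positivity)

/-- **The loss of a Galerkin limit is controlled by the enstrophy of the datum, a.e. in time**: for `0 < lo`, finite `Z(w₀)`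
and `0 < T`, for a.e. `t ∈ (0,T)`: `∫‖w₀‖² − ∫‖w t‖² ≤ 2·|hi|·t·e^{2#dGt}·Z(w₀)` (energy identity of the weak solution
`2·lim_K ∫_{(0,t]} Q_K = ∫‖w₀‖² − ∫‖w t‖²`, `IsWeakTensorPassiveVectorOn.ae_tendsto_setIntegral_symbForm`, and
`symbForm_le_enstrophy`). [cite: Temam1984, Ch. III §1 Lemma 1.2, §2 (3.41)–(3.47)] -/
theorem PVSSetup.IsGalerkinLimit.ae_loss_le_enstrophy (hl : h.IsGalerkinLimit φ c w) (hlo : 0 < lo)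
    (hZ : eGradNormSq w₀ ≠ ⊤) {T : ℝ} (hT : 0 < T) :
    ∀ᵐ t ∂(volume.restrict (Ioo 0 T)),
      (∫ x, ‖w₀ x‖ ^ 2) - ∫ x, ‖w t x‖ ^ 2 ≤
        2 * |hi| * t * Real.exp (2 * ((Fintype.card d : ℝ) * G) * t) * (eGradNormSq w₀).toReal := by
  have hsol := hl.isWeakTensorPassiveVectorOn hT
  have h𝔸T : NearIso (majorTranspose 𝔸) lo hi := (nearIso_majorTranspose_iff 𝔸 lo hi).2 h.nearIso
  have hlim := hsol.ae_tendsto_setIntegral_symbForm h𝔸T hlo h.memLp h.divFree (h.carrier.memLp_top_stLift T)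
  set Q : ℕ → ℝ → ℝ := fun N s => 4 * Real.pi ^ 2 * ∑ k ∈ freqBall N, (⟪c s k, symbT 𝔸 k (c s k)⟫_ℂ).re with hQ
  set E₀ : ℝ := ∫ x, ‖w₀ x‖ ^ 2 with hE₀
  set Z : ℝ := (eGradNormSq w₀).toReal with hZdef
  have hZ0 : 0 ≤ Z := ENNReal.toReal_nonneg
  have hcG : 0 ≤ 2 * ((Fintype.card d : ℝ) * G) := by have := h.carrier.grad_nonneg; positivity
  have hcongr : ∀ (t : ℝ) (N : ℕ), (∫ s in Ioc 0 t, 4 * Real.pi ^ 2 * ∑ k ∈ FunctionSpaces.Torus.freqBall N,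
      (⟪mFourierCoeff (FunctionSpaces.EuclideanSpace.complexify ∘ w s) k,
        symbT (majorTranspose 𝔸) k (mFourierCoeff (FunctionSpaces.EuclideanSpace.complexify ∘ w s) k)⟫_ℂ).re) =
      ∫ s in Ioc 0 t, Q N s := by
    intro t N
    refine setIntegral_congr_fun measurableSet_Ioc fun s hs => ?_
    simp only [hQ]
    congr 1
    exact Finset.sum_congr rfl fun k _ => by rw [hl.coeff_eq s hs.1.le k, re_inner_symbT_majorTranspose_self]
  have hlim' : ∀ᵐ t ∂(volume.restrict (Ioo 0 T)),
      Tendsto (fun N => ∫ s in Ioc 0 t, Q N s) atTop (𝓝 ((E₀ - ∫ x, ‖w t x‖ ^ 2) / 2)) :=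
    hlim.mono fun t ht => ht.congr fun N => hcongr t N
  have hQc : ∀ N, ContinuousOn (Q N) (Ici 0) := fun N => continuousOn_symbForm₁ 𝔸 N fun k => hl.continuousOn_coeff k
  filter_upwards [hlim', ae_restrict_mem measurableSet_Ioo] with t htl htI
  have hB : ∀ N, ∫ s in Ioc 0 t, Q N s ≤ t * (|hi| * Real.exp (2 * ((Fintype.card d : ℝ) * G) * t) * Z) := by
    intro N
    have hint : IntegrableOn (Q N) (Ioc 0 t) volume :=
      ((hQc N).mono Icc_subset_Ici_self).integrableOn_Icc.mono_set Ioc_subset_Icc_self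
    calc ∫ s in Ioc 0 t, Q N s ≤ ∫ s in Ioc 0 t, |hi| * Real.exp (2 * ((Fintype.card d : ℝ) * G) * t) * Z := by
          refine setIntegral_mono_on hint (integrableOn_const measure_Ioc_lt_top.ne) measurableSet_Ioc fun s hs => ?_
          refine (hl.symbForm_le_enstrophy N hs.1.le hZ).trans ?_
          have hexp : Real.exp (2 * ((Fintype.card d : ℝ) * G) * s) ≤ Real.exp (2 * ((Fintype.card d : ℝ) * G) * t) :=
            Real.exp_le_exp.2 (mul_le_mul_of_nonneg_left hs.2 hcG)
          exact mul_le_mul_of_nonneg_right (mul_le_mul_of_nonneg_left hexp (abs_nonneg hi)) hZ0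
      _ = t * (|hi| * Real.exp (2 * ((Fintype.card d : ℝ) * G) * t) * Z) := by
          rw [setIntegral_const, smul_eq_mul, measureReal_def, Real.volume_Ioc, ENNReal.toReal_ofReal (by linarith [htI.1]),
            sub_zero]
  have := le_of_tendsto' htl hB
  linarith

end Galerkin

/-! ## §2 The propagator side -/

section Propagator

variable {T : ℝ} {lo hi : ℝ} {b : ℝ → UnitAddTorus d → EuclideanSpace ℝ d} {M G : ℝ}
  {U : ℝ → ℝ → (Lp (EuclideanSpace ℝ d) 2 (volume : Measure (UnitAddTorus d)) →L[ℝ]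
    Lp (EuclideanSpace ℝ d) 2 (volume : Measure (UnitAddTorus d)))}

/-- **The loss of the propagator is controlled by the enstrophy of the datum, interior times.** For `IsPropagator T b 𝔹 U`,
`NearIso 𝔹 lo hi`, `0 < lo`, `SmoothCarrier b M G`, `0 ≤ s ≤ t < T` and a weakly divergence-free `f ∈ L²` with
`eGradNormSq f < ∞`: `‖f‖² − ‖U s t f‖² ≤ 2·|hi|·(t−s)·e^{2#dG(t−s)}·Z(f)` (Galerkin limit from `f` along `b(s+·)` at tensor `𝔹ᵀ`,
`IsGalerkinLimit.ae_loss_le_enstrophy`, `repr`, continuity of `τ ↦ ‖U s (s+τ) f‖²`). [cite: Temam1984, Ch. III §2 (3.41)–(3.47)] -/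
theorem IsPropagator.loss_le_enstrophy_of_lt {𝔹 : Visc4 d} (hU : IsPropagator T b 𝔹 U) (h𝔹 : NearIso 𝔹 lo hi)
    (hlo : 0 < lo) (hb : SmoothCarrier b M G) {s t : ℝ} (hs : 0 ≤ s) (hst : s ≤ t) (htT : t < T)
    {f : UnitAddTorus d → EuclideanSpace ℝ d} (hf : MemLp f 2 volume) (hdiv : FunctionSpaces.Torus.IsWeaklyDivFree f)
    (hZ : eGradNormSq f ≠ ⊤) :
    ‖hf.toLp f‖ ^ 2 - ‖U s t (hf.toLp f)‖ ^ 2 ≤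
      2 * |hi| * (t - s) * Real.exp (2 * ((Fintype.card d : ℝ) * G) * (t - s)) * (eGradNormSq f).toReal := by
  set y := hf.toLp f with hydef
  have hy : FunctionSpaces.Torus.IsWeaklyDivFree (y : UnitAddTorus d → EuclideanSpace ℝ d) :=
    hdiv.congr_ae (MemLp.coeFn_toLp hf).symm
  rcases hst.eq_or_lt with heq | hst'
  · subst heq
    rw [hU.self_of_divFree s hs htT.le y hy]
    simp
  have hsT : s < T := hst'.trans htT
  -- the carrier on `(0, T)`
  have hbT : MemLp (stLift b) ∞ (volume.restrict (Ioo 0 T ×ˢ univ)) := hb.memLp_top_stLift T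
  have hbdiv : ∀ᵐ τ ∂(volume.restrict (Ioo 0 T)), FunctionSpaces.Torus.IsWeaklyDivFree (b τ) :=
    ae_of_all _ fun τ => hb.isWeaklyDivFree τ
  -- the energy `E(τ) = ‖U s (s+τ) y‖²` is continuous on `[0, T − s)`
  set E : ℝ → ℝ := fun τ => ‖U s (s + τ) y‖ ^ 2 with hEdef
  have hEc : ContinuousOn E (Ico 0 (T - s)) :=
    (hU.continuousOn_norm_sq h𝔹 hlo hbT hbdiv hs hsT y hy).comp (continuous_const.add continuous_id).continuousOn
      fun τ hτ => ⟨by linarith [hτ.1], by linarith [hτ.2]⟩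
  -- the Galerkin limit from `f` along `b (s + ·)` at tensor `𝔹ᵀ`, a weak solution at tensor `𝔹`, represented by `U`
  have hP : PVSSetup (majorTranspose 𝔹) lo hi (fun τ => b (s + τ)) M G f :=
    ⟨(nearIso_majorTranspose_iff 𝔹 lo hi).2 h𝔹, hlo.le, hb.comp_add s, hf, hdiv⟩
  obtain ⟨φ, c, w, hl⟩ := hP.exists_isGalerkinLimit
  have hsol : IsWeakTensorPassiveVectorOn 0 (T - s) 𝔹 (fun τ => b (s + τ)) f w := by
    simpa only [majorTranspose_majorTranspose] using hl.isWeakTensorPassiveVectorOn (sub_pos.2 hsT)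
  have hrep := hU.repr s hs hsT f hf hdiv w hsol
  have hE0 : (∫ z, ‖f z‖ ^ 2) = ‖y‖ ^ 2 := (norm_toLp_sq_eq_integral hf).symm
  have hae1 : ∀ᵐ τ ∂(volume.restrict (Ioo 0 (T - s))), (∫ z, ‖w τ z‖ ^ 2) = E τ := by
    filter_upwards [hrep] with τ hτ
    obtain ⟨hm, he⟩ := hτ
    rw [hEdef]
    simp only
    rw [← he, norm_toLp_sq_eq_integral hm]
  have hae2 := hl.ae_loss_le_enstrophy hlo hZ (sub_pos.2 hsT)
  have hae : ∀ᵐ τ ∂(volume.restrict (Ioo 0 (T - s))),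
      ‖y‖ ^ 2 - E τ ≤ 2 * |hi| * τ * Real.exp (2 * ((Fintype.card d : ℝ) * G) * τ) * (eGradNormSq f).toReal := by
    filter_upwards [hae1, hae2] with τ h1 h2
    rw [h1, hE0] at h2
    exact h2
  -- a.e. `τ` ⟹ the time `θ = t − s` by continuity
  set θ : ℝ := t - s with hθdef
  have hθ0 : 0 < θ := by rw [hθdef]; linarith
  have hθT : θ < T - s := by rw [hθdef]; linarith
  have hsub : Ioo 0 θ ⊆ Ioo 0 (T - s) := Ioo_subset_Ioo le_rfl hθT.le
  have hEc1 : ContinuousOn E (Icc 0 θ) := hEc.mono fun τ hτ => ⟨hτ.1, lt_of_le_of_lt hτ.2 hθT⟩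
  have hf' : ContinuousOn (fun τ => ‖y‖ ^ 2 - E τ) (Icc 0 θ) := continuousOn_const.sub hEc1
  have hg' : ContinuousOn (fun τ => 2 * |hi| * τ * Real.exp (2 * ((Fintype.card d : ℝ) * G) * τ) *
      (eGradNormSq f).toReal) (Icc 0 θ) :=
    (((continuous_const.mul continuous_id).mul (Real.continuous_exp.comp (continuous_const.mul continuous_id))).mul
      continuous_const).continuousOn
  have hfg : ∀ᵐ τ ∂(volume.restrict (Ioo 0 θ)),
      ‖y‖ ^ 2 - E τ ≤ 2 * |hi| * τ * Real.exp (2 * ((Fintype.card d : ℝ) * G) * τ) * (eGradNormSq f).toReal :=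
    ae_restrict_of_ae_restrict_of_subset hsub hae
  have key := le_on_Icc_of_ae_le_of_continuousOn₂ hθ0 hf' hg' hfg θ ⟨hθ0.le, le_rfl⟩
  have hEθ : E θ = ‖U s t y‖ ^ 2 := by
    simp only [hEdef, hθdef, add_sub_cancel]
  rw [hEθ] at key
  simpa only [hθdef] using key

/-- **THE LOSS OF THE PASSIVE-VECTOR PROPAGATOR IS CONTROLLED BY THE ENSTROPHY OF THE DATUM** (all admissible times, endpoint
included). For the solution propagator `IsPropagator T b 𝔹 U` with `NearIso 𝔹 lo hi`, `0 < lo`, a smooth carrier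
`SmoothCarrier b M G`, times `0 ≤ s ≤ t ≤ T`, and a weakly divergence-free datum `f ∈ L²(T^d; ℝ^d)` of finite spectral enstrophy
`Z(f) = eGradNormSq f = 4π² Σ_k |k|²‖f̂(k)‖²`:

  `‖f‖² − ‖U s t f‖² ≤ 2 · |hi| · (t − s) · exp(2 · #d · G · (t − s)) · Z(f)`

(dissipation rate `D(τ) ≤ |hi|·‖∇u(τ)‖² ≤ |hi|·e^{2#dG(τ−s)}·‖∇f‖²` by the enstrophy Gronwall inequality with constant `2#d·sup|∇b|`,
proved on Fourier–Galerkin approximants and passed to the limit, `loss_le_enstrophy_of_lt`; the endpoint `t = T` through the propagator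
on the horizon `T + 1`, which restricts to `U` by uniqueness). For a solenoidal real trigonometric polynomial `f = realTrigPoly S c`,
`Z(f) = 4π² Σ_{k∈S} |k|²‖c k‖²` (`eGradNormSq_realTrigPoly`).
[cite: Temam1984, Ch. III §2 (3.41)–(3.47)] [cite: ConstantinFoias1988, Ch. 10] [cite: Pazy1983, Ch. 5 §5.1 Thm. 5.3] -/
theorem IsPropagator.loss_le_enstrophy [Nonempty d] {𝔹 : Visc4 d} (hU : IsPropagator T b 𝔹 U) (h𝔹 : NearIso 𝔹 lo hi)
    (hlo : 0 < lo) (hb : SmoothCarrier b M G) {s t : ℝ} (hs : 0 ≤ s) (hst : s ≤ t) (htT : t ≤ T)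
    {f : UnitAddTorus d → EuclideanSpace ℝ d} (hf : MemLp f 2 volume) (hdiv : FunctionSpaces.Torus.IsWeaklyDivFree f)
    (hZ : eGradNormSq f ≠ ⊤) :
    ‖hf.toLp f‖ ^ 2 - ‖U s t (hf.toLp f)‖ ^ 2 ≤
      2 * |hi| * (t - s) * Real.exp (2 * ((Fintype.card d : ℝ) * G) * (t - s)) * (eGradNormSq f).toReal := by
  have hb₁ : MemLp (stLift b) ∞ (volume.restrict (Ioo 0 (T + 1) ×ˢ univ)) := hb.memLp_top_stLift (T + 1)
  have hbdiv₁ : ∀ᵐ τ ∂(volume.restrict (Ioo 0 (T + 1))), FunctionSpaces.Torus.IsWeaklyDivFree (b τ) :=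
    ae_of_all _ fun τ => hb.isWeaklyDivFree τ
  have hbT : MemLp (stLift b) ∞ (volume.restrict (Ioo 0 T ×ˢ univ)) := hb.memLp_top_stLift T
  have hbdivT : ∀ᵐ τ ∂(volume.restrict (Ioo 0 T)), FunctionSpaces.Torus.IsWeaklyDivFree (b τ) :=
    ae_of_all _ fun τ => hb.isWeaklyDivFree τ
  obtain ⟨U₁, hU₁⟩ := exists_isPropagator h𝔹 hlo hb₁ hbdiv₁
  have hU₁T : IsPropagator T b 𝔹 U₁ := hU₁.of_horizon_le h𝔹 hlo hb₁ hbdiv₁ (by linarith)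
  rw [hU.eq_of_isPropagator hU₁T h𝔹 hlo hbT hbdivT hs hst htT (hf.toLp f)]
  exact hU₁.loss_le_enstrophy_of_lt h𝔹 hlo hb hs hst (by linarith) hf hdiv hZ

/-- The same for an `L²` class `y` with weakly divergence-free representative of finite spectral enstrophy.
[cite: Temam1984, Ch. III §2 (3.41)–(3.47)] -/
theorem IsPropagator.loss_le_enstrophy' [Nonempty d] {𝔹 : Visc4 d} (hU : IsPropagator T b 𝔹 U) (h𝔹 : NearIso 𝔹 lo hi)
    (hlo : 0 < lo) (hb : SmoothCarrier b M G) {s t : ℝ} (hs : 0 ≤ s) (hst : s ≤ t) (htT : t ≤ T)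
    (y : Lp (EuclideanSpace ℝ d) 2 (volume : Measure (UnitAddTorus d)))
    (hy : FunctionSpaces.Torus.IsWeaklyDivFree (y : UnitAddTorus d → EuclideanSpace ℝ d))
    (hZ : eGradNormSq (y : UnitAddTorus d → EuclideanSpace ℝ d) ≠ ⊤) :
    ‖y‖ ^ 2 - ‖U s t y‖ ^ 2 ≤
      2 * |hi| * (t - s) * Real.exp (2 * ((Fintype.card d : ℝ) * G) * (t - s)) *
        (eGradNormSq (y : UnitAddTorus d → EuclideanSpace ℝ d)).toReal := by
  have h := hU.loss_le_enstrophy h𝔹 hlo hb hs hst htT (Lp.memLp y) hy hZ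
  rwa [Lp.toLp_coeFn y (Lp.memLp y)] at h

/-! ## §3 The adjoint (backward) problem: the same bound for the adjoint loss -/

/-- **The carrier of the backward problem is a smooth carrier with the same constants**: `r ↦ −b(t − r)` is jointly continuous
with smooth divergence-free slices, `‖·‖ ≤ M` and `|∂·| ≤ G`. [cite: Temam1984, Ch. III §1 Lemma 1.2] -/
theorem SmoothCarrier.reverse (hb : SmoothCarrier b M G) (t : ℝ) :
    SmoothCarrier (fun r => -b (t - r)) M G where
  continuous := by
    have e : (uncurry fun r => -b (t - r)) = fun p : ℝ × UnitAddTorus d => -(uncurry b (t - p.1, p.2)) := by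
      funext ⟨r, x⟩; rfl
    rw [e]
    exact (hb.continuous.comp ((continuous_const.sub continuous_fst).prodMk continuous_snd)).neg
  smooth := fun r => (hb.smooth (t - r)).neg
  divFree := fun r x => by
    have h0 := hb.divFree (t - r) x
    unfold FunctionSpaces.Torus.divergence at h0 ⊢
    have e : ∀ i, FunctionSpaces.Torus.partialDeriv i (fun y => (-b (t - r)) y i) x =
        -FunctionSpaces.Torus.partialDeriv i (fun y => b (t - r) y i) x := by
      intro i
      have e1 : (fun y => (-b (t - r)) y i) = fun y => -(fun y => b (t - r) y i) y := by
        funext y; simp only [Pi.neg_apply, PiLp.neg_apply]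
      rw [e1, partialDeriv_neg]
    simp_rw [e]
    rw [Finset.sum_neg_distrib, h0, neg_zero]
  norm_le := fun r x => by
    rw [Pi.neg_apply, norm_neg]
    exact hb.norm_le (t - r) x
  grad_nonneg := hb.grad_nonneg
  grad_le := fun r x c a => by
    have e : FunctionSpaces.Torus.partialDeriv c (-b (t - r)) x = -FunctionSpaces.Torus.partialDeriv c (b (t - r)) x := by
      have e1 : (-b (t - r)) = fun y => -(b (t - r) y) := by funext y; rfl
      rw [e1, partialDeriv_neg]
    rw [e, PiLp.neg_apply, abs_neg]
    exact hb.grad_le (t - r) x c a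

/-- **THE ADJOINT LOSS IS CONTROLLED BY THE ENSTROPHY OF THE DATUM.** For `IsPropagator T b 𝔹 U` (`NearIso 𝔹 lo hi`, `0 < lo`,
`SmoothCarrier b M G`), `0 ≤ s ≤ t ≤ T`, and a weakly divergence-free `f ∈ L²` of finite spectral enstrophy:
`‖f‖² − ‖(U s t)† f‖² ≤ 2·|hi|·(t − s)·e^{2#dG(t−s)}·Z(f)` — the adjoint `(U s t)†` is the propagator of the backward problem on the
window (tensor `𝔹ᵀ`, carrier `r ↦ −b(t−r)`: `IsPropagator.adjoint_eq`, `isPropagator_propagator`), which has the same Legendre–Hadamard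
constants (`nearIso_majorTranspose_iff`) and the same carrier constants (`SmoothCarrier.reverse`), so `loss_le_enstrophy` applies to it.
[cite: Temam1984, Ch. III §1 Lemma 1.2, §2 (3.41)–(3.47)] [cite: Pazy1983, Ch. 1 §1.10] -/
theorem IsPropagator.lossAdj_le_enstrophy [Nonempty d] {𝔹 : Visc4 d} (hU : IsPropagator T b 𝔹 U) (h𝔹 : NearIso 𝔹 lo hi)
    (hlo : 0 < lo) (hb : SmoothCarrier b M G) {s t : ℝ} (hs : 0 ≤ s) (hst : s ≤ t) (htT : t ≤ T)
    {f : UnitAddTorus d → EuclideanSpace ℝ d} (hf : MemLp f 2 volume) (hdiv : FunctionSpaces.Torus.IsWeaklyDivFree f)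
    (hZ : eGradNormSq f ≠ ⊤) :
    ‖hf.toLp f‖ ^ 2 - ‖ContinuousLinearMap.adjoint (U s t) (hf.toLp f)‖ ^ 2 ≤
      2 * |hi| * (t - s) * Real.exp (2 * ((Fintype.card d : ℝ) * G) * (t - s)) * (eGradNormSq f).toReal := by
  have hbT : MemLp (stLift b) ∞ (volume.restrict (Ioo 0 T ×ˢ univ)) := hb.memLp_top_stLift T
  have hbdivT : ∀ᵐ τ ∂(volume.restrict (Ioo 0 T)), FunctionSpaces.Torus.IsWeaklyDivFree (b τ) :=
    ae_of_all _ fun τ => hb.isWeaklyDivFree τ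
  set y := hf.toLp f with hydef
  have hy : FunctionSpaces.Torus.IsWeaklyDivFree (y : UnitAddTorus d → EuclideanSpace ℝ d) :=
    hdiv.congr_ae (MemLp.coeFn_toLp hf).symm
  rcases hst.eq_or_lt with heq | hst'
  · subst heq
    have hself : U s s = (divFreeL2 d).starProjection :=
      ContinuousLinearMap.ext fun z => hU.apply_self h𝔹 hlo hbT hbdivT hs htT z
    have hPy : (divFreeL2 d).starProjection y = y :=
      Submodule.starProjection_eq_self_iff.2 ((mem_divFreeL2_iff y).2 hy)
    rw [hself, (isSelfAdjoint_starProjection (divFreeL2 d)).adjoint_eq, hPy]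
    simp
  have h𝔹T : NearIso (majorTranspose 𝔹) lo hi := (nearIso_majorTranspose_iff 𝔹 lo hi).2 h𝔹
  have hb' := memLp_top_stLift_reversed_window hbT hs htT
  have hbdiv' := ae_isWeaklyDivFree_reversed_window hbdivT hs htT
  rw [hU.adjoint_eq h𝔹 hlo hbT hbdivT hs hst' htT]
  have hV := isPropagator_propagator h𝔹T hlo hb' hbdiv'
  have key := hV.loss_le_enstrophy h𝔹T hlo (hb.reverse t) le_rfl (sub_nonneg.2 hst) le_rfl hf hdiv hZ
  rw [sub_zero] at key
  exact key

end Propagator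

end Torus

end Literature.Analysis.FluidPDE
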